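import Summits.BirchSwinnertonDyer.Rank2.Family81517MinimalOrdinary
import HarnessLib

/-!
# Certified partners of Greenberg type A, I₃″: the full-`2`-torsion neighbour `W″_i` for `D ≡ 3 (mod 4)` (cell `bsd-rank2`)

Cell `bsd-rank2` (D-0036), seat `bsd-rank2-lit` GEN 18, stub `stub_partnerCF` (E1M line `cfsplit`), TYPE A, branch
`D = 4i + 3`: the CF-habitat neighbour `W″_i = ⟨1, −9i−11, 0, 36i+27, 0⟩ : y² + xy = x³ − (9i+11)x² + 9(4i+3)x` of the
partner `W′_i` of `Rank2/CertifiedPartnerTypeAModelThree.lean` — the minimal model (`x = 16x′`, `y = 64y′ + 32x′`) of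
`Y² = X(X − 36D)(X − 64)`, the quotient of `Y² = X(X² + (18D+32)X + (16−9D)²)` by `⟨(0,0)⟩`.
* `Δ(W″_i) = 81·(4i+3)²·(36i+11)²` (odd), `c₄(W″_i) = 1296i² + 1368i + 553` (`≡ 1 (mod 3)`, odd); Bezout:
  `c₄ − (4i+3)(324i+99) = 256`, `c₄ − (36i+11)(36i+27) = 256` ⇒ GLOBAL MINIMAL MODEL, elliptic, GOOD ORDINARY at `2`
  (reduction `y² + xy = x³ + (ī+1)x² + x`). The isogeny `W″_i ~ W′_i` and the `2`-torsion bookkeeping are in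
  `Rank2/CertifiedPartnerTypeANeighbourIsogeny.lean` / `Rank2/CertifiedPartnerTypeA.lean`.

PARTITION: none — r_an ≥ 2, summit axis S0; TWIN (D-0056): n/a. B1: explicit-model algebra (discriminant,
`c₄`, Silverman's minimality criterion, reduction mod `2`); no `L`-function, no Selmer group, no S0 motion.
No named fact, no `sorry`. Templates: `Rank2/CertifiedPartnerTypeBModel.lean`, `Rank2/Family81517MinimalOrdinary.lean`.
-/

namespace Summit.BirchSwinnertonDyer.Rank2

open _root_.WeierstrassCurve
open Literature.NumberTheory.EllipticCurves
open Literature.NumberTheory.EllipticCurves.Rank1Residual.X11RankOneCertificates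

section NeighbourTypeAModelThree

/-! ### The integer model, its discriminant and `c₄` -/

/-- The discriminant of the integer model. [folklore] -/
theorem neighbourAThreeInt_Δ (i : ℤ) :
    (⟨1, -9 * i - 11, 0, 36 * i + 27, 0⟩ : WeierstrassCurve ℤ).Δ =
      81 * (4 * i + 3) ^ 2 * (36 * i + 11) ^ 2 := by
  simp only [WeierstrassCurve.Δ, WeierstrassCurve.b₂, WeierstrassCurve.b₄, WeierstrassCurve.b₆,
    WeierstrassCurve.b₈]
  ring

/-- The certificate schema's `discOf` of the integer model. [folklore] -/
theorem discOf_neighbourAThree (i : ℤ) :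
    discOf [1, -9 * i - 11, 0, 36 * i + 27, 0] = 81 * (4 * i + 3) ^ 2 * (36 * i + 11) ^ 2 := by
  rw [← neighbourAThreeInt_Δ]
  simp only [discOf, invariants, WeierstrassCurve.Δ, WeierstrassCurve.b₂, WeierstrassCurve.b₄,
    WeierstrassCurve.b₆, WeierstrassCurve.b₈]
  ring

/-- The certificate schema's `c4Of` of the integer model. [folklore] -/
theorem c4Of_neighbourAThree (i : ℤ) :
    c4Of [1, -9 * i - 11, 0, 36 * i + 27, 0] = 1296 * i ^ 2 + 1368 * i + 553 := by
  simp only [c4Of, invariants]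
  ring

/-- The rational model with all coefficients as integer casts. [folklore] -/
theorem neighbourAThree_model_eq_intCast (i : ℤ) :
    (⟨1, ((-9 * i - 11 : ℤ) : ℚ), ((0 : ℤ) : ℚ), ((36 * i + 27 : ℤ) : ℚ), ((0 : ℤ) : ℚ)⟩ :
      WeierstrassCurve ℚ) =
      ⟨((1 : ℤ) : ℚ), ((-9 * i - 11 : ℤ) : ℚ), ((0 : ℤ) : ℚ), ((36 * i + 27 : ℤ) : ℚ), ((0 : ℤ) : ℚ)⟩ := by
  ext <;> simp

/-- The rational model is the base change of the integer model. [folklore] -/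
theorem neighbourAThreeInt_baseChange (i : ℤ) :
    (⟨1, -9 * i - 11, 0, 36 * i + 27, 0⟩ : WeierstrassCurve ℤ).baseChange ℚ =
      (⟨1, ((-9 * i - 11 : ℤ) : ℚ), ((0 : ℤ) : ℚ), ((36 * i + 27 : ℤ) : ℚ), ((0 : ℤ) : ℚ)⟩ :
      WeierstrassCurve ℚ) := by
  rw [baseChange_int_eq_map]
  ext <;> simp [WeierstrassCurve.map]

/-- The discriminant of the rational model. [folklore] -/
theorem neighbourAThree_Δ (i : ℤ) :
    (⟨1, ((-9 * i - 11 : ℤ) : ℚ), ((0 : ℤ) : ℚ), ((36 * i + 27 : ℤ) : ℚ), ((0 : ℤ) : ℚ)⟩ :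
      WeierstrassCurve ℚ).Δ =
      81 * (4 * i + 3) ^ 2 * (36 * i + 11) ^ 2 := by
  simp only [WeierstrassCurve.Δ, WeierstrassCurve.b₂, WeierstrassCurve.b₄, WeierstrassCurve.b₆,
    WeierstrassCurve.b₈]
  push_cast
  ring

/-! ### Parities -/

/-- The discriminant is odd. [folklore] -/
theorem odd_Δ_neighbourAThree (i : ℤ) : Odd (81 * (4 * i + 3) ^ 2 * (36 * i + 11) ^ 2 : ℤ) := by
  have h81 : Odd (81 : ℤ) := by decide
  have h3 : Odd (4 * i + 3 : ℤ) := ⟨2 * i + 1, by ring⟩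
  have h11 : Odd (36 * i + 11 : ℤ) := ⟨18 * i + 5, by ring⟩
  exact (h81.mul h3.pow).mul h11.pow

/-- The discriminant is nonzero. [folklore] -/
theorem Δ_neighbourAThree_ne_zero (i : ℤ) : (81 * (4 * i + 3) ^ 2 * (36 * i + 11) ^ 2 : ℤ) ≠ 0 := by
  intro h
  have := Int.odd_iff.mp (odd_Δ_neighbourAThree i)
  rw [h] at this
  norm_num at this

/-! ### Silverman's criterion: no prime `q` with `q¹² ∣ Δ` and `q⁴ ∣ c₄` -/

/-- `3 ∤ 1296i² + 1368i + 553` (`≡ 1 (mod 3)`). [folklore] -/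
theorem not_three_dvd_neighbourAThree_c₄ (i : ℤ) : ¬ (3 : ℤ) ∣ 1296 * i ^ 2 + 1368 * i + 553 := by
  intro h3
  rw [show (1296 * i ^ 2 + 1368 * i + 553 : ℤ) = 3 * (432 * i ^ 2 + 456 * i + 184) + 1 by ring] at h3
  have := (dvd_add_right (Dvd.intro _ rfl)).mp h3
  omega

/-- **No prime `q` has `q¹² ∣ Δ` and `q⁴ ∣ c₄`** (Bezout certificates in the docstring of the file). [folklore] -/
theorem not_pow_dvd_Δ_and_c₄_neighbourAThree (i : ℤ) (q : ℕ) (hq : q.Prime) :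
    ¬ ((q : ℤ) ^ 12 ∣ 81 * (4 * i + 3) ^ 2 * (36 * i + 11) ^ 2 ∧
        (q : ℤ) ^ 4 ∣ 1296 * i ^ 2 + 1368 * i + 553) := by
  rintro ⟨h12, h4⟩
  have hqp : Prime (q : ℤ) := Nat.prime_iff_prime_int.mp hq
  have hq1 : (q : ℤ) ∣ 81 * (4 * i + 3) ^ 2 * (36 * i + 11) ^ 2 :=
    dvd_trans (dvd_pow_self (q : ℤ) (by norm_num)) h12
  have hf : (q : ℤ) ∣ 1296 * i ^ 2 + 1368 * i + 553 :=
    dvd_trans (dvd_pow_self (q : ℤ) (by norm_num)) h4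
  have hq3Z : ¬ (q : ℤ) ∣ 3 := by
    intro h
    have hq3' : q ∣ 3 := by exact_mod_cast h
    rcases (Nat.dvd_prime Nat.prime_three).mp hq3' with h1 | h1
    · exact hq.one_lt.ne' h1
    · subst h1; exact not_three_dvd_neighbourAThree_c₄ i (by exact_mod_cast hf)
  have hq81 : ¬ (q : ℤ) ∣ 81 := fun h ↦ hq3Z (hqp.dvd_of_dvd_pow (by norm_num; exact h : (q : ℤ) ∣ 3 ^ 4))
  have hfodd : ¬ (2 : ℤ) ∣ 1296 * i ^ 2 + 1368 * i + 553 :=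
    Int.two_dvd_ne_zero.mpr (Int.odd_iff.mp ⟨648 * i ^ 2 + 684 * i + 276, by ring⟩)
  have hq2' : ¬ (q : ℤ) ∣ 2 := by
    intro h
    have hq2'' : q ∣ 2 := by exact_mod_cast h
    rcases (Nat.dvd_prime Nat.prime_two).mp hq2'' with h1 | h1
    · exact hq.one_lt.ne' h1
    · subst h1; exact hfodd (by exact_mod_cast hf)
  have hΔ : (q : ℤ) ∣ (4 * i + 3) ^ 2 * (36 * i + 11) ^ 2 := by
    rw [mul_assoc] at hq1
    exact (hqp.dvd_or_dvd hq1).resolve_left hq81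
  rcases hqp.dvd_or_dvd hΔ with h3 | h11
  · have h3' : (q : ℤ) ∣ 4 * i + 3 := hqp.dvd_of_dvd_pow h3
    have hk : (q : ℤ) ∣ (1296 * i ^ 2 + 1368 * i + 553) - (4 * i + 3) * (324 * i + 99) :=
      dvd_sub hf (dvd_mul_of_dvd_left h3' _)
    rw [show ((1296 * i ^ 2 + 1368 * i + 553) - (4 * i + 3) * (324 * i + 99) : ℤ) = 2 ^ 8 by ring] at hk
    exact hq2' (hqp.dvd_of_dvd_pow hk)
  · have h11' : (q : ℤ) ∣ 36 * i + 11 := hqp.dvd_of_dvd_pow h11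
    have hk : (q : ℤ) ∣ (1296 * i ^ 2 + 1368 * i + 553) - (36 * i + 11) * (36 * i + 27) :=
      dvd_sub hf (dvd_mul_of_dvd_left h11' _)
    rw [show ((1296 * i ^ 2 + 1368 * i + 553) - (36 * i + 11) * (36 * i + 27) : ℤ) = 2 ^ 8 by ring] at hk
    exact hq2' (hqp.dvd_of_dvd_pow hk)

/-! ### Global minimality, the integral model, the minimal discriminant, ellipticity -/

/-- **The model is a global minimal model.** [folklore: Silverman AEC VII.1 Remark 1.1, VIII.8] -/
theorem isGloballyMinimal_neighbourAThree (i : ℤ) :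
    (⟨1, ((-9 * i - 11 : ℤ) : ℚ), ((0 : ℤ) : ℚ), ((36 * i + 27 : ℤ) : ℚ), ((0 : ℤ) : ℚ)⟩ :
      WeierstrassCurve ℚ).IsGloballyMinimal := by
  rw [neighbourAThree_model_eq_intCast]
  refine isGloballyMinimal_of_int_criterion _ _ _ _ _ fun q hq hboth => ?_
  obtain ⟨h12, h4⟩ := hboth
  rw [discOf_neighbourAThree] at h12
  rw [c4Of_neighbourAThree] at h4
  exact not_pow_dvd_Δ_and_c₄_neighbourAThree i q hq ⟨h12, h4⟩

/-- The tree's integral model of the rational model is the integer model itself. [folklore] -/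
theorem integralModelInt_neighbourAThree (i : ℤ) :
    haveI := isGloballyMinimal_neighbourAThree i
    integralModelInt (⟨1, ((-9 * i - 11 : ℤ) : ℚ), ((0 : ℤ) : ℚ), ((36 * i + 27 : ℤ) : ℚ), ((0 : ℤ) : ℚ)⟩ :
      WeierstrassCurve ℚ) = ⟨1, -9 * i - 11, 0, 36 * i + 27, 0⟩ := by
  haveI := isGloballyMinimal_neighbourAThree i
  have key : ∀ (X : WeierstrassCurve ℚ) [X.IsGloballyMinimal],
      (⟨1, -9 * i - 11, 0, 36 * i + 27, 0⟩ : WeierstrassCurve ℤ).baseChange ℚ = X →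
        integralModelInt X = ⟨1, -9 * i - 11, 0, 36 * i + 27, 0⟩ := by
    rintro X _ rfl
    exact integralModelInt_baseChange_int _
  exact key _ (neighbourAThreeInt_baseChange i)

/-- The minimal discriminant. [folklore] -/
theorem minimalDiscriminantInt_neighbourAThree (i : ℤ) :
    haveI := isGloballyMinimal_neighbourAThree i
    minimalDiscriminantInt (⟨1, ((-9 * i - 11 : ℤ) : ℚ), ((0 : ℤ) : ℚ), ((36 * i + 27 : ℤ) : ℚ), ((0 : ℤ) : ℚ)⟩ :
      WeierstrassCurve ℚ) = 81 * (4 * i + 3) ^ 2 * (36 * i + 11) ^ 2 := by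
  rw [minimalDiscriminantInt, integralModelInt_neighbourAThree, neighbourAThreeInt_Δ]

/-- The model is an elliptic curve (`Δ ≠ 0`). [folklore] -/
theorem isElliptic_neighbourAThree (i : ℤ) :
    (⟨1, ((-9 * i - 11 : ℤ) : ℚ), ((0 : ℤ) : ℚ), ((36 * i + 27 : ℤ) : ℚ), ((0 : ℤ) : ℚ)⟩ :
      WeierstrassCurve ℚ).IsElliptic := by
  refine ⟨isUnit_iff_ne_zero.mpr ?_⟩
  rw [neighbourAThree_Δ]
  exact_mod_cast Δ_neighbourAThree_ne_zero i

/-! ### Good ordinary reduction at `2` -/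

/-- **Good reduction at `2`** (`Δ` odd). [folklore: Silverman AEC VII.1 Remark 1.1] -/
theorem hasGoodReductionAtPrime_two_neighbourAThree (i : ℤ) :
    haveI := isGloballyMinimal_neighbourAThree i
    (⟨1, ((-9 * i - 11 : ℤ) : ℚ), ((0 : ℤ) : ℚ), ((36 * i + 27 : ℤ) : ℚ), ((0 : ℤ) : ℚ)⟩ :
      WeierstrassCurve ℚ).HasGoodReductionAtPrime 2 := by
  haveI := isGloballyMinimal_neighbourAThree i
  refine hasGoodReductionAtPrime_of_not_dvd _ 2 ?_
  rw [minimalDiscriminantInt_neighbourAThree]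
  exact_mod_cast Int.two_dvd_ne_zero.mpr (Int.odd_iff.mp (odd_Δ_neighbourAThree i))

/-- The reduction of the integer model modulo `2`. [folklore] -/
theorem neighbourAThreeInt_map_zmod_two (i : ℤ) :
    (⟨1, -9 * i - 11, 0, 36 * i + 27, 0⟩ : WeierstrassCurve ℤ).map (Int.castRingHom (ZMod 2)) =
      ⟨1, (i : ZMod 2) + 1, 0, 1, 0⟩ := by
  have h2 : ((2 : ℤ) : ZMod 2) = 0 := by decide
  have ha₂ : ((-9 * i - 11 : ℤ) : ZMod 2) = (i : ZMod 2) + 1 := by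
    rw [show (-9 * i - 11 : ℤ) = 2 * (-5 * i - 6) + (i + 1) by ring, Int.cast_add, Int.cast_mul, h2,
      zero_mul, zero_add]; push_cast; ring
  have ha₃ : ((0 : ℤ) : ZMod 2) = 0 := by
    rw [show (0 : ℤ) = 2 * (0) + (0) by ring, Int.cast_add, Int.cast_mul, h2,
      zero_mul, zero_add]; push_cast; ring
  have ha₄ : ((36 * i + 27 : ℤ) : ZMod 2) = 1 := by
    rw [show (36 * i + 27 : ℤ) = 2 * (18 * i + 13) + (1) by ring, Int.cast_add, Int.cast_mul, h2,
      zero_mul, zero_add]; push_cast; ring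
  have ha₆ : ((0 : ℤ) : ZMod 2) = 0 := by
    rw [show (0 : ℤ) = 2 * (0) + (0) by ring, Int.cast_add, Int.cast_mul, h2,
      zero_mul, zero_add]; push_cast; ring
  ext
  · show (Int.castRingHom (ZMod 2)) 1 = 1
    rw [map_one]
  · show (Int.castRingHom (ZMod 2)) (-9 * i - 11) = (i : ZMod 2) + 1
    rw [eq_intCast, ha₂]
  · show (Int.castRingHom (ZMod 2)) (0) = 0
    rw [eq_intCast, ha₃]
  · show (Int.castRingHom (ZMod 2)) (36 * i + 27) = 1
    rw [eq_intCast, ha₄]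
  · show (Int.castRingHom (ZMod 2)) (0) = 0
    rw [eq_intCast, ha₆]

/-- **Ordinary at `2`**: the trace `3 − #W̃(𝔽₂) ∈ {1, −1}` is odd. [folklore] -/
theorem not_two_dvd_frobeniusTrace_neighbourAThree (i : ℤ) :
    haveI := isGloballyMinimal_neighbourAThree i
    ¬ ((2 : ℕ) : ℤ) ∣ frobeniusTrace (⟨1, ((-9 * i - 11 : ℤ) : ℚ), ((0 : ℤ) : ℚ), ((36 * i + 27 : ℤ) : ℚ), ((0 : ℤ) : ℚ)⟩ :
      WeierstrassCurve ℚ) 2 := by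
  haveI := isGloballyMinimal_neighbourAThree i
  rw [frobeniusTrace, reductionPointCount, integralModelInt_neighbourAThree, neighbourAThreeInt_map_zmod_two]
  rcases natCard_point_F2_family81517 ((i : ZMod 2) + 1) with h | h <;> rw [h] <;> norm_num

/-- **Good ordinary at `2`** (for the minimality instance above). [folklore] -/
theorem isOrdinaryAt_two_neighbourAThree (i : ℤ) :
    @IsOrdinaryAt (⟨1, ((-9 * i - 11 : ℤ) : ℚ), ((0 : ℤ) : ℚ), ((36 * i + 27 : ℤ) : ℚ), ((0 : ℤ) : ℚ)⟩ :
      WeierstrassCurve ℚ)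
      (isGloballyMinimal_neighbourAThree i) 2 _ :=
  ⟨hasGoodReductionAtPrime_two_neighbourAThree i, not_two_dvd_frobeniusTrace_neighbourAThree i⟩

end NeighbourTypeAModelThree

end Summit.BirchSwinnertonDyer.Rank2
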